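import Summits.QuantumFields.YangMills.Theorems.PencilRigidityNPointIsotropyDoubledOrbitKernelDegOneToolbox
import Summits.QuantumFields.YangMills.Theorems.MirrorModularBoostsPlanarSpectralConeDensityHelpers

/-!
# Degree-one doubled orbit kernel, III: the transform through the universal measure

Line `complex-rotation-bandlimit` of crux `PencilRigidity.NPointIsotropy` (stmt-QuantumFields-11686), registered
stub `doubledOrbitKernel_degOne_of_universal`: third of four support files (independent of file II).  The Laplace–Fourier transform
`f̃(p) = ∫ f(x) e^{−x⁰p₀ + i x⃗·p⃗} dx` of a one-point test function (section variable `lf`, pinned by `hlf`) and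
the hypothesis of a UNIVERSAL two-point measure `μ₀` (`|f̃|² μ₀` is a joint spectral measure of `Ψ_f` for every
positive-time one-point `f`, `h : OSReconstructionNoE1 S₁.toLabelled`):

* NORMS and POLARISATION through `μ₀`: `∫ |f̃|² dμ₀ = ‖Ψ_f‖²` (total mass of a joint spectral measure) and
  `⟪Ψ_f, Ψ_g⟫ = ∫ conj f̃ · g̃ dμ₀` for compactly supported time-ordered `f, g` (`Ψ` is linear in the test function
  in `ℋ`, `f̃` is linear, `inner_eq_sum_norm_sq_div_four`);
* OFF-CONE VANISHING: if `|f̃|²μ₀` gives no mass to `{p₀ < |p₁|}` then `f̃ = 0` `μ₀`-a.e. there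
  (registered form `transform_ae_eq_zero_off_cone`).

The real-angle identification with the boosted symbol and the atoms are in file IV.
-/

noncomputable section

namespace Summit.QuantumFields.YangMills.Theorems.NPointIsotropy.ComplexRotationBandlimit

namespace DegOne

open MeasureTheory Complex Set Filter Topology Metric
open scoped ComplexConjugate SchwartzMap LineDeriv InnerProductSpace
open Literature.MathematicalPhysics.QuantumLattice Literature.MathematicalPhysics.QuantumFieldTheory
open Summit.QuantumFields.YangMills.Theorems.NPointIsotropy.Negative (E4)
open Summit.QuantumFields.YangMills.Cruxes.PlanarSpectralCone.PositivityDiscToOperatorCone.Density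
  (fieldVec_add fieldVec_smul fieldVec_sub isTimeOrdered_add isTimeOrdered_sub)

variable {lf : 𝓢((Fin 1 → E4), ℂ) → E4 → ℂ}

/-- The Laplace–Fourier integrand of a compactly supported test function is integrable. [folklore] -/
theorem integrable_lf_integrand (f : 𝓢((Fin 1 → E4), ℂ))
    (hfc : HasCompactSupport (f : (Fin 1 → E4) → ℂ)) (p : E4) :
    Integrable (fun x : Fin 1 → E4 => f x * Complex.exp (-(((x 0) 0 * p 0 : ℝ) : ℂ) +
      ((∑ j : Fin 3, (x 0) j.succ * p j.succ : ℝ) : ℂ) * Complex.I)) volume :=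
  (by fun_prop : Continuous fun x : Fin 1 → E4 => f x * Complex.exp (-(((x 0) 0 * p 0 : ℝ) : ℂ) +
      ((∑ j : Fin 3, (x 0) j.succ * p j.succ : ℝ) : ℂ) * Complex.I)).integrable_of_hasCompactSupport
    hfc.mul_right

section Transform

variable (hlf : lf = fun f p => ∫ x : Fin 1 → E4, f x * Complex.exp (-(((x 0) 0 * p 0 : ℝ) : ℂ) +
    ((∑ j : Fin 3, (x 0) j.succ * p j.succ : ℝ) : ℂ) * Complex.I))
include hlf

/-- The transform is Borel measurable in the momentum. [folklore] -/
theorem stronglyMeasurable_lf (f : 𝓢((Fin 1 → E4), ℂ)) : StronglyMeasurable (lf f) := by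
  subst hlf
  have hc : Continuous fun q : E4 × (Fin 1 → E4) => f q.2 * Complex.exp (-(((q.2 0) 0 * q.1 0 : ℝ) : ℂ) +
      ((∑ j : Fin 3, (q.2 0) j.succ * q.1 j.succ : ℝ) : ℂ) * Complex.I) := by
    fun_prop
  exact hc.stronglyMeasurable.integral_prod_right

/-- The transform is additive on compactly supported test functions. [folklore] -/
theorem lf_add (f g : 𝓢((Fin 1 → E4), ℂ)) (hfc : HasCompactSupport (f : (Fin 1 → E4) → ℂ))
    (hgc : HasCompactSupport (g : (Fin 1 → E4) → ℂ)) (p : E4) :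
    lf (f + g) p = lf f p + lf g p := by
  subst hlf
  dsimp only
  rw [← integral_add (integrable_lf_integrand f hfc p) (integrable_lf_integrand g hgc p)]
  congr 1; funext x
  rw [show (f + g) x = f x + g x from rfl]
  ring

/-- The transform is subtractive on compactly supported test functions. [folklore] -/
theorem lf_sub (f g : 𝓢((Fin 1 → E4), ℂ)) (hfc : HasCompactSupport (f : (Fin 1 → E4) → ℂ))
    (hgc : HasCompactSupport (g : (Fin 1 → E4) → ℂ)) (p : E4) :
    lf (f - g) p = lf f p - lf g p := by
  subst hlf
  dsimp only
  rw [← integral_sub (integrable_lf_integrand f hfc p) (integrable_lf_integrand g hgc p)]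
  congr 1; funext x
  rw [show (f - g) x = f x - g x from rfl]
  ring

/-- The transform is homogeneous. [folklore] -/
theorem lf_smul (c : ℂ) (f : 𝓢((Fin 1 → E4), ℂ)) (p : E4) : lf (c • f) p = c * lf f p := by
  subst hlf
  dsimp only
  rw [← integral_const_mul]
  congr 1; funext x
  rw [show (c • f) x = c * f x from rfl]
  ring

section Spectral

variable {S₁ : SchwingerFamily E4} (h : OSReconstructionNoE1 S₁.toLabelled) (μ₀ : Measure E4)

/-- **The universal measure computes norms**: if `|f̃|² μ₀` is a joint spectral measure of `ψ`
then `|f̃|²` is `μ₀`-integrable with integral `‖ψ‖²`. [folklore] -/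
theorem integral_norm_sq_lf {ψ : h.Hilbert} {f : 𝓢((Fin 1 → E4), ℂ)}
    (hμf : h.IsJointSpectralMeasure ψ (μ₀.withDensity fun p => ENNReal.ofReal (‖lf f p‖ ^ 2))) :
    Integrable (fun p => ‖lf f p‖ ^ 2) μ₀ ∧ ∫ p, ‖lf f p‖ ^ 2 ∂μ₀ = ‖ψ‖ ^ 2 := by
  have hm : AEStronglyMeasurable (fun p => ‖lf f p‖ ^ 2) μ₀ :=
    ((stronglyMeasurable_lf hlf f).measurable.norm.pow_const 2).aestronglyMeasurable
  haveI := hμf.isFiniteMeasure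
  have huniv := hμf.measureReal_univ
  rw [measureReal_def, withDensity_apply _ MeasurableSet.univ, Measure.restrict_univ] at huniv
  have hlt : ∫⁻ p, ENNReal.ofReal (‖lf f p‖ ^ 2) ∂μ₀ < ⊤ := by
    have := measure_lt_top (μ₀.withDensity fun p => ENNReal.ofReal (‖lf f p‖ ^ 2)) Set.univ
    rwa [withDensity_apply _ MeasurableSet.univ, Measure.restrict_univ] at this
  have hnn : 0 ≤ᵐ[μ₀] fun p => ‖lf f p‖ ^ 2 := ae_of_all _ fun p => by positivity
  refine ⟨⟨hm, (hasFiniteIntegral_iff_ofReal hnn).2 hlt⟩, ?_⟩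
  rw [integral_eq_lintegral_of_nonneg_ae hnn hm, huniv]

/-- **Polarisation through the universal measure**: `⟪Ψ_f, Ψ_g⟫ = ∫ conj f̃ · g̃ dμ₀` for compactly
supported time-ordered one-point `f, g`. [folklore] -/
theorem inner_fieldVec_eq_integral_lf
    (hμ : ∀ (f : 𝓢((Fin 1 → E4), ℂ)) (hf : IsTimeOrdered f),
      h.IsJointSpectralMeasure (h.fieldVec 1 (fun _ => ()) f hf)
        (μ₀.withDensity fun p => ENNReal.ofReal (‖lf f p‖ ^ 2)))
    {f g : 𝓢((Fin 1 → E4), ℂ)} (hf : IsTimeOrdered f) (hg : IsTimeOrdered g)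
    (hfc : HasCompactSupport (f : (Fin 1 → E4) → ℂ)) (hgc : HasCompactSupport (g : (Fin 1 → E4) → ℂ)) :
    ⟪h.fieldVec 1 (fun _ => ()) f hf, h.fieldVec 1 (fun _ => ()) g hg⟫_ℂ =
      ∫ p, conj (lf f p) * lf g p ∂μ₀ := by
  have hIg : IsTimeOrdered (Complex.I • g) := OSReconstructionNoE1.isTimeOrdered_smul _ hg
  have hIgc := hasCompactSupport_smul Complex.I hgc
  have h1t := isTimeOrdered_add hf hg
  have h2t := isTimeOrdered_sub hf hg
  have h3t := isTimeOrdered_sub hf hIg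
  have h4t := isTimeOrdered_add hf hIg
  obtain ⟨i1, n1⟩ := integral_norm_sq_lf hlf h μ₀ (hμ (f + g) h1t)
  obtain ⟨i2, n2⟩ := integral_norm_sq_lf hlf h μ₀ (hμ (f - g) h2t)
  obtain ⟨i3, n3⟩ := integral_norm_sq_lf hlf h μ₀ (hμ (f - Complex.I • g) h3t)
  obtain ⟨i4, n4⟩ := integral_norm_sq_lf hlf h μ₀ (hμ (f + Complex.I • g) h4t)
  have l1 : ∀ p, lf (f + g) p = lf f p + lf g p := lf_add hlf f g hfc hgc
  have l2 : ∀ p, lf (f - g) p = lf f p - lf g p := lf_sub hlf f g hfc hgc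
  have l3 : ∀ p, lf (f - Complex.I • g) p = lf f p - Complex.I * lf g p := fun p => by
    rw [lf_sub hlf f _ hfc hIgc, lf_smul hlf]
  have l4 : ∀ p, lf (f + Complex.I • g) p = lf f p + Complex.I * lf g p := fun p => by
    rw [lf_add hlf f _ hfc hIgc, lf_smul hlf]
  rw [inner_eq_sum_norm_sq_div_four, RCLike.I_to_complex, ← fieldVec_add h hf hg h1t,
    ← fieldVec_sub h hf hg h2t, ← fieldVec_smul h _ hg hIg, ← fieldVec_sub h hf hIg h3t,
    ← fieldVec_add h hf hIg h4t]
  simp only [RCLike.ofReal_eq_complex_ofReal]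
  rw [← Complex.ofReal_pow, ← Complex.ofReal_pow, ← Complex.ofReal_pow, ← Complex.ofReal_pow,
    ← n1, ← n2, ← n3, ← n4]
  simp_rw [l1] at i1 ⊢
  simp_rw [l2] at i2 ⊢
  simp_rw [l3] at i3 ⊢
  simp_rw [l4] at i4 ⊢
  rw [← integral_complex_ofReal, ← integral_complex_ofReal, ← integral_complex_ofReal,
    ← integral_complex_ofReal, ← integral_sub i1.ofReal i2.ofReal, ← integral_sub i3.ofReal i4.ofReal,
    ← integral_mul_const, ← integral_add, ← integral_div]
  · exact integral_congr_ae (ae_of_all _ fun p => polarization_pointwise (lf f p) (lf g p))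
  · exact i1.ofReal.sub i2.ofReal
  · exact (i3.ofReal.sub i4.ofReal).mul_const _

/-- **Off-cone vanishing**: if `|f̃|²μ₀` gives no mass to `{p₀ < |p₁|}`, then `f̃ = 0` `μ₀`-a.e. there. [folklore] -/
theorem lf_ae_eq_zero_off_cone {f : 𝓢((Fin 1 → E4), ℂ)}
    (hzero : (μ₀.withDensity fun p => ENNReal.ofReal (‖lf f p‖ ^ 2)) {p : E4 | p 0 < |p 1|} = 0) :
    ∀ᵐ p ∂μ₀, p ∈ {p : E4 | p 0 < |p 1|} → lf f p = 0 := by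
  have hA : MeasurableSet {p : E4 | p 0 < |p 1|} :=
    measurableSet_lt (by fun_prop) (by fun_prop)
  have hmeas : Measurable fun p => ENNReal.ofReal (‖lf f p‖ ^ 2) :=
    ENNReal.measurable_ofReal.comp ((stronglyMeasurable_lf hlf f).measurable.norm.pow_const 2)
  rw [withDensity_apply _ hA, lintegral_eq_zero_iff hmeas] at hzero
  have h2 : ∀ᵐ p ∂μ₀, p ∈ {p : E4 | p 0 < |p 1|} →
      ENNReal.ofReal (‖lf f p‖ ^ 2) = (0 : E4 → ENNReal) p :=
    (ae_restrict_iff' hA).1 hzero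
  filter_upwards [h2] with p hp hpA
  have h3 := hp hpA
  simp only [Pi.zero_apply, ENNReal.ofReal_eq_zero] at h3
  have h4 : ‖lf f p‖ ^ 2 = 0 := le_antisymm h3 (by positivity)
  exact norm_eq_zero.1 ((pow_eq_zero_iff two_ne_zero).1 h4)

end Spectral

end Transform

end DegOne

/-- **Off-cone vanishing of the Laplace–Fourier transform** (registered form of file III's
`DegOne.lf_ae_eq_zero_off_cone`, with the transform written out): if `|f̃|²μ₀` gives no mass to `{p₀ < |p₁|}` then
`f̃ = 0` `μ₀`-a.e. there. [folklore] -/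
theorem transform_ae_eq_zero_off_cone : ∀ (μ₀ : MeasureTheory.Measure (EuclideanSpace ℝ (Fin 4))) (f : SchwartzMap (Fin 1 → EuclideanSpace ℝ (Fin 4)) ℂ), (μ₀.withDensity fun p : EuclideanSpace ℝ (Fin 4) => ENNReal.ofReal (‖∫ x : Fin 1 → EuclideanSpace ℝ (Fin 4), f x * Complex.exp (-(((x 0) 0 * p 0 : ℝ) : ℂ) + ((∑ j : Fin 3, (x 0) j.succ * p j.succ : ℝ) : ℂ) * Complex.I)‖ ^ 2)) {p : EuclideanSpace ℝ (Fin 4) | p 0 < |p 1|} = 0 → ∀ᵐ p ∂μ₀, p ∈ {p : EuclideanSpace ℝ (Fin 4) | p 0 < |p 1|} → (∫ x : Fin 1 → EuclideanSpace ℝ (Fin 4), f x * Complex.exp (-(((x 0) 0 * p 0 : ℝ) : ℂ) + ((∑ j : Fin 3, (x 0) j.succ * p j.succ : ℝ) : ℂ) * Complex.I)) = 0 :=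
  fun μ₀ _ hzero => DegOne.lf_ae_eq_zero_off_cone rfl μ₀ hzero

end Summit.QuantumFields.YangMills.Theorems.NPointIsotropy.ComplexRotationBandlimit

end
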